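import Summits.HubbardSuperconductivity.HubbardSuperconductivity.Theorems.AnisotropyChordTowerSectorSpace
import Literature.Probability.LatticeModels.IsingTransport

/-!
# Route `AnisotropyChord` / H0 rotor rung: THE SOLVED TWO-MAGNON VECTOR `v` (`A v = u`, `v ⟂ 1`, `S⁻ v = 0`) of the
# first-order perturbation theory around the ferromagnetic point (work-order v13(c) of theory seat
# `hubbard-h0-rotor-theory-1`, memo ROTOR-THEORY-11 §160 (β2), §161 (c); director CYCLE-12 ruling (A))

* `lowerSum_permAct`, `lowerSum_add'/sub'/finsum/ite/zero'`, **`lowerSum_fmOp`** (`[S⁻_tot, A] = 0`), `lowerSum_support'`;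
* `secEquivPowerset`, `sum_sec_eq_sum_powersetCard`, **`card_sec`** (`|Sec V n| = C(|V|, n)`);
* `sum_sec_two_edgeMinusMean` (`u = edgeMinusMean G κ ⟂ 1` on a graph with constant vertex degree `d = κ(|V|−1)`),
  `sum_ind_one_mul_lowerSum` (`Σ_{|σ|₀=1} (S⁻b)(σ) = 2 Σ_{|τ|₀=2} b(τ)`), and
  **`exists_solved_twoMagnon`**: on a connected graph with constant degree there is `v : Sec V 2 → ℝ` with `Σ v = 0`,
  `A_2 v = u` and `S⁻ (ext v) = 0` (the vector whose raising tower is the first-order correction `φ₁` of THEOREM P′);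
* `torus_degree_const` : the torus graph has constant vertex degree (translation invariance, tree `torusGraph_adj_add_right`).
-/

set_option linter.dupNamespace false
set_option autoImplicit false

noncomputable section

open Finset Matrix
open Summit.HubbardSuperconductivity.HubbardSuperconductivity.Theorems.AnisotropyChord.InsertionEntropy
open Literature.Probability.LatticeModels

namespace Summit.HubbardSuperconductivity.HubbardSuperconductivity.Theorems.AnisotropyChord.Tower

variable {V : Type} [Fintype V] [DecidableEq V]

/-! ### `S⁻_tot`: permutation equivariance, linearity, commutation with `A` -/

section Lower

/-- `S⁻_tot` commutes with the permutation action. [folklore] -/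
theorem lowerSum_permAct (π : Equiv.Perm V) (b : (V → Fin 2) → ℝ) :
    lowerSum (permAct π b) = permAct π (lowerSum b) := by
  funext τ
  unfold lowerSum permAct
  simp only [Function.comp_apply]
  have h : ∀ x, (if τ (π x) = 1 then b (Function.update (τ ∘ ⇑π) x 0) else 0)
      = (fun x' => if τ x' = 1 then b ((Function.update τ x' 0) ∘ ⇑π) else 0) (π x) := by
    intro x; simp only [update_comp_perm]
  calc (∑ x, if τ x = 1 then b (Function.update τ x 0 ∘ ⇑π) else 0)
      = ∑ x, (fun x' => if τ x' = 1 then b ((Function.update τ x' 0) ∘ ⇑π) else 0) (π x) :=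
        (Equiv.sum_comp π (fun x' => if τ x' = 1 then b ((Function.update τ x' 0) ∘ ⇑π) else 0)).symm
    _ = ∑ x, if τ (π x) = 1 then b (Function.update (τ ∘ ⇑π) x 0) else 0 :=
        Finset.sum_congr rfl (fun x _ => (h x).symm)

/-- `S⁻_tot` is additive (difference form). [folklore] -/
theorem lowerSum_sub' (b c : (V → Fin 2) → ℝ) :
    lowerSum (fun σ => b σ - c σ) = fun σ => lowerSum b σ - lowerSum c σ := by
  funext σ; unfold lowerSum; rw [← Finset.sum_sub_distrib]
  refine Finset.sum_congr rfl fun x _ => ?_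
  split_ifs <;> simp

/-- `S⁻_tot 0 = 0`. [folklore] -/
theorem lowerSum_zero' : lowerSum (fun _ : V → Fin 2 => (0:ℝ)) = fun _ => 0 := by
  funext σ; unfold lowerSum; simp

/-- `S⁻_tot` commutes with finite sums. [folklore] -/
theorem lowerSum_finsum {ι : Type} (s : Finset ι) (F : ι → (V → Fin 2) → ℝ) :
    lowerSum (fun σ => ∑ i ∈ s, F i σ) = fun σ => ∑ i ∈ s, lowerSum (F i) σ := by
  funext σ; unfold lowerSum
  have hι : ∀ (z : V) (E : ℝ), (if σ z = 1 then E else 0) = (if σ z = 1 then (1:ℝ) else 0) * E := by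
    intro z E; split_ifs <;> simp
  simp_rw [hι _ (∑ i ∈ s, _), Finset.mul_sum]
  rw [Finset.sum_comm]
  refine Finset.sum_congr rfl fun i _ => Finset.sum_congr rfl fun z _ => ?_
  rw [hι z (F i _)]

/-- `S⁻_tot` of a conditional amplitude. [folklore] -/
theorem lowerSum_ite (p : Prop) [Decidable p] (c : (V → Fin 2) → ℝ) :
    lowerSum (fun σ => if p then c σ else 0) = fun σ => if p then lowerSum c σ else 0 := by
  by_cases hp : p
  · simp only [hp, if_true]
  · simp only [hp, if_false]; exact lowerSum_zero'

variable (G : SimpleGraph V) [DecidableRel G.Adj]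

/-- **`[S⁻_tot, A] = 0`**: the transposition form commutes with the lowering operator. [folklore] -/
theorem lowerSum_fmOp (b : (V → Fin 2) → ℝ) : lowerSum (fmOp G b) = fmOp G (lowerSum b) := by
  have hF : fmOp G b = fun τ => (1/4 : ℝ) * ∑ x ∈ (univ : Finset V), (fun x τ => ∑ y ∈ (univ : Finset V),
      (fun y τ => if G.Adj x y then (b τ - permAct (Equiv.swap x y) b τ) else 0) y τ) x τ := by
    funext τ; rfl
  rw [hF, lowerSum_smul, lowerSum_finsum]
  funext σ
  show (1/4 : ℝ) * ∑ x, lowerSum (fun τ => ∑ y, (fun y τ => if G.Adj x y then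
      (b τ - permAct (Equiv.swap x y) b τ) else 0) y τ) σ = fmOp G (lowerSum b) σ
  simp_rw [lowerSum_finsum]
  unfold fmOp
  congr 1
  refine Finset.sum_congr rfl fun x _ => Finset.sum_congr rfl fun y _ => ?_
  rw [lowerSum_ite]
  by_cases hxy : G.Adj x y
  · simp only [hxy, if_true]
    rw [lowerSum_sub', lowerSum_permAct]
    rfl
  · simp [hxy]

/-- `S⁻_tot` lowers the particle number by one: support of `S⁻ b`. [folklore] -/
theorem lowerSum_support' (b : (V → Fin 2) → ℝ) (n : ℝ) (hsupp : ∀ ν, b ν ≠ 0 → zerosCard ν = n) :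
    ∀ τ, lowerSum b τ ≠ 0 → zerosCard τ = n - 1 := by
  intro τ hτ
  unfold lowerSum at hτ
  obtain ⟨y, -, hy⟩ := Finset.exists_ne_zero_of_sum_ne_zero hτ
  have hy1 : τ y = 1 := by by_contra h; simp [h] at hy
  rw [if_pos hy1] at hy
  have hz := hsupp _ hy
  -- `zerosCard (update τ y 0) = zerosCard τ + 1`
  have h0 : Function.update τ y 0 y = 0 := by simp
  have h1 := zerosCard_update_one h0
  rw [Function.update_idem, (Function.update_eq_self_iff (f := τ) (a := y) (b := (1 : Fin 2))).2 hy1.symm] at h1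
  linarith

end Lower

/-! ### The sector as a set of subsets; its cardinality -/

section Card

/-- `Sec V n ≃ {T ⊆ V : |T| = n}` via the zero set. [folklore] -/
def secEquivPowerset (n : ℕ) : Sec V n ≃ {T : Finset V // T ∈ (univ : Finset V).powersetCard n} where
  toFun s := ⟨zeroSet s.1, by rw [Finset.mem_powersetCard]; exact ⟨Finset.subset_univ _, s.2⟩⟩
  invFun T := ⟨cfgOf T.1, by rw [zeroSet_cfgOf]; exact (Finset.mem_powersetCard.1 T.2).2⟩
  left_inv s := by apply Subtype.ext; exact cfgOf_zeroSet s.1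
  right_inv T := by apply Subtype.ext; exact zeroSet_cfgOf T.1

/-- Sums over the sector are sums over `n`-subsets. [folklore] -/
theorem sum_sec_eq_sum_powersetCard (n : ℕ) (F : (V → Fin 2) → ℝ) :
    ∑ s : Sec V n, F s.1 = ∑ T ∈ (univ : Finset V).powersetCard n, F (cfgOf T) := by
  rw [← Finset.sum_coe_sort ((univ : Finset V).powersetCard n)]
  rw [← Equiv.sum_comp (secEquivPowerset n).symm]
  rfl

/-- **`|Sec V n| = C(|V|, n)`.** [folklore] -/
theorem card_sec (n : ℕ) : Fintype.card (Sec V n) = (Fintype.card V).choose n := by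
  rw [Fintype.card_congr (secEquivPowerset (V := V) n), Fintype.card_coe, Finset.card_powersetCard, Finset.card_univ]

end Card

/-! ### The two-magnon right-hand side `u` and the solved vector `v` -/

section Solve

variable (G : SimpleGraph V) [DecidableRel G.Adj]

omit [DecidableEq V] in
/-- `edgeMinusMean` is supported on the two-particle sector. [folklore] -/
theorem edgeMinusMean_support (κ : ℝ) : ∀ τ, edgeMinusMean G κ τ ≠ 0 → zerosCard τ = 2 := by
  intro τ hτ
  unfold edgeMinusMean at hτ
  by_contra h
  rw [if_neg h] at hτ
  exact hτ rfl

/-- `ext (res u) = u` for `u = edgeMinusMean`. [folklore] -/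
theorem secExt_secRes_edgeMinusMean (κ : ℝ) : secExt 2 (secRes 2 (edgeMinusMean G κ)) = edgeMinusMean G κ :=
  secExt_secRes _ fun τ hτ => by rw [edgeMinusMean_support G κ τ hτ]; norm_num

/-- **`u ⟂ 1`**: on a graph with constant vertex degree `d = κ(|V| − 1)`, `Σ_{|T|=2} u(T) = 0`. [folklore] -/
theorem sum_sec_two_edgeMinusMean (d : ℕ) (κ : ℝ) (hreg : ∀ x : V, (∑ y, if G.Adj x y then (1:ℝ) else 0) = d)
    (hκ : κ * ((Fintype.card V : ℝ) - 1) = d) :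
    ∑ s : Sec V 2, secRes 2 (edgeMinusMean G κ) s = 0 := by
  unfold secRes
  rw [sum_sec_eq_sum_powersetCard 2 (edgeMinusMean G κ)]
  have h1 : ∀ T ∈ (univ : Finset V).powersetCard 2,
      edgeMinusMean G κ (cfgOf T) = (1/2 : ℝ) * insideOrd G (cfgOf T) - κ := by
    intro T hT
    unfold edgeMinusMean
    rw [if_pos]
    rw [zerosCard_eq_card, zeroSet_cfgOf, (Finset.mem_powersetCard.1 hT).2]; norm_num
  rw [Finset.sum_congr rfl h1, Finset.sum_sub_distrib, ← Finset.mul_sum, sum_powersetCard_two_insideOrd,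
    Finset.sum_const, Finset.card_powersetCard, Finset.card_univ, nsmul_eq_mul, Nat.cast_choose_two]
  have hD : (∑ x ∈ (univ : Finset V), ∑ y ∈ (univ : Finset V), if G.Adj x y then (1:ℝ) else 0)
      = (d : ℝ) * Fintype.card V := by
    rw [Finset.sum_congr rfl fun x _ => hreg x, Finset.sum_const, Finset.card_univ, nsmul_eq_mul, mul_comm]
  rw [hD, ← hκ]
  ring

/-- `raiseSum` of the one-particle indicator is twice the two-particle indicator. [folklore] -/
theorem raiseSum_ind_one (σ : V → Fin 2) :
    raiseSum (fun τ : V → Fin 2 => if zerosCard τ = 1 then (1:ℝ) else 0) σ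
      = if zerosCard σ = 2 then 2 else 0 := by
  unfold raiseSum
  have h : ∀ x, (if σ x = 0 then (if zerosCard (Function.update σ x 1) = 1 then (1:ℝ) else 0) else 0)
      = (if σ x = 0 then (1:ℝ) else 0) * (if zerosCard σ = 2 then 1 else 0) := by
    intro x
    by_cases hx : σ x = 0
    · have h1 := zerosCard_update_one hx
      have e : (zerosCard (Function.update σ x 1) = 1) ↔ (zerosCard σ = 2) := by
        constructor <;> intro h <;> linarith
      simp only [hx, if_true, one_mul]
      by_cases h2 : zerosCard σ = 2
      · rw [if_pos h2, if_pos (e.2 h2)]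
      · rw [if_neg h2, if_neg (fun h => h2 (e.1 h))]
    · simp [hx]
  simp_rw [h]
  rw [← Finset.sum_mul]
  have hz : (∑ x, if σ x = 0 then (1:ℝ) else 0) = zerosCard σ := by
    unfold zerosCard; rw [← Finset.sum_filter]; simp
  rw [hz]
  split_ifs with h2
  · rw [h2]; norm_num
  · simp

/-- **`Σ_{|σ|₀ = 1} (S⁻ b)(σ) = 2·Σ_τ b(τ)`** for `b` supported on the two-particle sector. [folklore] -/
theorem sum_ind_one_mul_lowerSum (b : (V → Fin 2) → ℝ) (hb : ∀ ν, b ν ≠ 0 → zerosCard ν = 2) :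
    ∑ σ, (if zerosCard σ = 1 then (1:ℝ) else 0) * lowerSum b σ = 2 * ∑ τ, b τ := by
  rw [sum_mul_lowerSum_eq_sum_raiseSum_mul, Finset.mul_sum]
  refine Finset.sum_congr rfl fun τ _ => ?_
  rw [raiseSum_ind_one]
  by_cases h : b τ = 0
  · simp [h]
  · rw [if_pos (hb τ h)]

/-- **THE SOLVED TWO-MAGNON VECTOR.**  On a connected graph with constant vertex degree `d = κ(|V|−1)` there is
`v : Sec V 2 → ℝ` with `Σ v = 0`, `A_2 v = u` (`u = edgeMinusMean G κ`) and `S⁻_tot (ext v) = 0`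
(`[S⁻, A] = 0`, `S⁻ u = 0`, and `ker A` on the one-particle sector is the constants). [folklore] -/
theorem exists_solved_twoMagnon (hconn : G.Connected) (d : ℕ) (κ : ℝ)
    (hreg : ∀ x : V, (∑ y, if G.Adj x y then (1:ℝ) else 0) = d) (hκ : κ * ((Fintype.card V : ℝ) - 1) = d) :
    ∃ v : Sec V 2 → ℝ, ∑ s, v s = 0 ∧ secOp G 2 v = secRes 2 (edgeMinusMean G κ) ∧
      lowerSum (secExt 2 v) = fun _ => 0 := by
  obtain ⟨v, hv, hAv⟩ := secOp_solve G hconn (secRes 2 (edgeMinusMean G κ))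
    (sum_sec_two_edgeMinusMean G d κ hreg hκ)
  refine ⟨v, hv, hAv, ?_⟩
  set b := secExt 2 v with hbdef
  have hb2 : ∀ ν, b ν ≠ 0 → zerosCard ν = 2 := fun ν hν => by
    rw [secExt_support v ν hν]; norm_num
  -- `A (ext v) = u`
  have hAb : fmOp G b = edgeMinusMean G κ := by
    rw [hbdef, ← secExt_secOp, hAv, secExt_secRes_edgeMinusMean]
  -- `ℓ := S⁻ b` is killed by `A`, hence constant on the one-particle sector
  set ℓ := lowerSum b with hℓdef
  have hAℓ : fmOp G ℓ = fun _ => 0 := by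
    rw [hℓdef, ← lowerSum_fmOp, hAb, lowerSum_edgeMinusMean G d κ hreg hκ]
  have h0 : ∑ σ, ℓ σ * fmOp G ℓ σ = 0 := by rw [hAℓ]; simp
  have hconst := sectorFun_of_edgeSwapInvariant G hconn ℓ (swapInvariant_of_inner_fmOp_eq_zero G ℓ h0)
  have hℓsupp : ∀ τ, ℓ τ ≠ 0 → zerosCard τ = 1 := fun τ hτ => by
    have := lowerSum_support' b 2 hb2 τ hτ; rw [this]; norm_num
  -- the sum over the one-particle sector of `ℓ` vanishes
  have hsum : ∑ σ, (if zerosCard σ = 1 then (1:ℝ) else 0) * ℓ σ = 0 := by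
    rw [hℓdef, sum_ind_one_mul_lowerSum b hb2, hbdef]
    have := sum_secExt_mul v (fun _ => (1:ℝ))
    simp only [mul_one] at this
    rw [this, hv, mul_zero]
  funext τ
  by_cases hτ : zerosCard τ = 1
  · -- every one-particle configuration carries the same value `ℓ τ`
    have hall : ∑ σ, (if zerosCard σ = 1 then (1:ℝ) else 0) * ℓ σ
        = ℓ τ * ∑ σ : V → Fin 2, (if zerosCard σ = 1 then (1:ℝ) else 0) := by
      rw [Finset.mul_sum]
      refine Finset.sum_congr rfl fun σ _ => ?_
      by_cases hσ : zerosCard σ = 1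
      · rw [if_pos hσ, hconst σ τ (by rw [hσ, hτ])]; ring
      · simp [hσ]
    have hpos : 0 < ∑ σ : V → Fin 2, (if zerosCard σ = 1 then (1:ℝ) else 0) := by
      have hle : (if zerosCard τ = 1 then (1:ℝ) else 0) ≤ ∑ σ : V → Fin 2, (if zerosCard σ = 1 then (1:ℝ) else 0) :=
        Finset.single_le_sum (f := fun σ : V → Fin 2 => if zerosCard σ = 1 then (1:ℝ) else 0)
          (fun σ _ => by positivity) (Finset.mem_univ τ)
      rw [if_pos hτ] at hle
      linarith
    rw [hall] at hsum
    rcases mul_eq_zero.1 hsum with h | h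
    · exact h
    · exact absurd h hpos.ne'
  · by_contra hne
    exact hτ (hℓsupp τ hne)

end Solve

/-! ### The torus graph has constant vertex degree -/

section TorusDegree

variable {L : ℕ} [NeZero L]

/-- **Translation invariance ⇒ constant degree**: every site of the torus `(ℤ/L)^2` has the same number of
neighbours as the origin (`4` for `L ≥ 3`, `2` for `L = 2`, `0` for `L = 1`). [folklore] -/
theorem torus_degree_const (x : TorusSite 2 L) :
    (∑ y, if (torusGraph 2 L).Adj x y then (1:ℝ) else 0)
      = ((univ.filter fun z : TorusSite 2 L => (torusGraph 2 L).Adj 0 z).card : ℕ) := by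
  have h : ∀ y, ((torusGraph 2 L).Adj x y) ↔ (torusGraph 2 L).Adj 0 (y - x) := by
    intro y
    have := torusGraph_adj_add_right (-x) x y
    rw [add_neg_cancel, ← sub_eq_add_neg] at this
    exact this.symm
  simp_rw [h]
  rw [show (∑ y, if (torusGraph 2 L).Adj 0 (y - x) then (1:ℝ) else 0)
      = ∑ z, if (torusGraph 2 L).Adj 0 z then (1:ℝ) else 0 from
    (Equiv.sum_comp (Equiv.subRight x) (fun z => if (torusGraph 2 L).Adj 0 z then (1:ℝ) else 0))]
  rw [← Finset.sum_filter]; simp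

end TorusDegree

end Summit.HubbardSuperconductivity.HubbardSuperconductivity.Theorems.AnisotropyChord.Tower
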